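import Summits.CriticalPhenomena.PercolationContinuityZ3.Theses.PercNearOneGluing
import Literature.Probability.Percolation.PercolationEvents
import HarnessLib.Audit
import Summits.CriticalPhenomena.PercolationContinuityZ3.Theorems.PercNearOneGluingNearOneGluingVariants2415

/-! TTRL-lite variant V2440 of stmt-CriticalPhenomena-4574

(`stub_shorteningStep` of line `kn_shortening_induction`, move `specialise+small_case`:
`n := 4` and `A.card ≤ 2`).  This variant is a specialisation of the already-landed sibling variant
V2415 (`A.card ≤ 2`, any `n`, `stub_shorteningStep_var2415`) at `n = 4`.  (Mathematically, V2415 is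
Kozma–Nitzan's shortening step, Conjecture 6 of arXiv:2401.12397 measured against the minimiser
`a₀` of the uncontracted graph, for at most two relays: transport of the three glued probabilities
to `prodBernoulli w` along `ω ↦ insert s(v,x) ω`, Harris, and Kozma–Nitzan Lemma 3 for the
mixed-monotone set-observer event `{V ↔ a₁} ∩ {V ↮ a₀}`, `V = {v, x}`, fed by the minimiser
hypothesis; see the docstring of V2415.)  No new definitions, no named facts, the induction
hypothesis is not used. -/

namespace Summit.CriticalPhenomena.PercolationContinuityZ3.Theorems

open MeasureTheory Set Literature.Probability.LatticeModels Literature.Probability.Percolation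
open scoped Classical BigOperators

/-- TTRL-lite variant V2440 of `stub_shorteningStep` (stmt-CriticalPhenomena-4574, Kozma–Nitzan
Conjecture 6 with the induction hypothesis displayed): the shortening step
`μ(⋃ a ∈ A, v ↔ a) · μ(a₀ ↔ b) ≤ μ(v ↔ b)` for the glued measure `μ = prodBernoulli (w[s(v,x) ↦ 1])`
on `Fin 4`, in the small case `A.card ≤ 2`.  Immediate from the sibling variant
`stub_shorteningStep_var2415` (case `A.card ≤ 2`, any `n`) at `n = 4`. -/
theorem stub_shorteningStep_var2440 : ∀ (w : Sym2 (Fin 4) → unitInterval) (A : Finset (Fin 4)) (b v x a₀ : Fin 4), A.card ≤ 2 → v ∉ A → v ≠ x → w s(v, x) = 0 → a₀ ∈ A → (∀ a ∈ A, (prodBernoulli w).real (openConn a₀ b) ≤ (prodBernoulli w).real (openConn a b)) → (∀ w' : Sym2 (Fin 4) → unitInterval, (∀ e, w e = 0 → w' e = 0) → ∀ (A' : Finset (Fin 4)) (o' b' : Fin 4) (t : ℝ), (∀ a ∈ A', t ≤ (prodBernoulli w').real (openConn a b')) → (prodBernoulli w').real (⋃ a ∈ A', openConn o' a) * t ≤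 (prodBernoulli w').real (openConn o' b')) → (prodBernoulli (Function.update w s(v, x) 1)).real (⋃ a ∈ A, openConn v a) * (prodBernoulli (Function.update w s(v, x) 1)).real (openConn a₀ b) ≤ (prodBernoulli (Function.update w s(v, x) 1)).real (openConn v b) := by
  intro w A b v x a₀ hcard
  exact stub_shorteningStep_var2415 4 w A b v x a₀ hcard

end Summit.CriticalPhenomena.PercolationContinuityZ3.Theorems
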